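import Summits.QuantumFields.YangMills.Theorems.ToronValleyVolumePeriodicRingCeilingBox
import Summits.QuantumFields.YangMills.Theorems.SwapTwistDeficitPeriodicRingFloorLeaderEvent
import Summits.QuantumFields.YangMills.Theorems.SwapTwistDeficitPeriodicRingFloorLog
import Summits.QuantumFields.YangMills.Theorems.ToronValleyVolumeNearlyCommutingCeiling
import HarnessLib

/-!
# The fixed-`L` periodic CEILING, II: `μ_L{F₀ ≤ u} ≤ C_L · u^{9L⁴−3/2} · log u⁻¹`
# (free-hands support of ⟨stmt-QuantumFields-24497⟩ `ToronValleyVolume.ToronTubeVolumeLaw`; the other half of ✓`PeriodicRingFloor.log_volume_floor`, w3 g61)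

With part I (✓`PeriodicRingCeiling.commBox_of_ringDeficit`: a deficit `≤ u` puts the tree-gauged ring history into the nearly-commuting box with leader
tolerance `s = 20L²√u` and fluctuation radius `t₂ = 12L²√u`), the Fubini bookkeeping of ✓`PeriodicRingFloor.pi_real_mul_ballVol_pow_le_ringMeasure_real_deficit_le`
(w3 g61; reproduced here with the inclusion REVERSED — its change of variables `Ψ`, leader identification `Θ` and mass identity are generic) gives

* ★★ `ringMeasure_real_deficit_le_le_box` — `μ_L{F₀ ≤ u} ≤ Haar⁴{C | pairwise ‖q(C_k)q(C_l) − q(C_l)q(C_k)‖ ≤ 20L²√u} · ballVol(12L²√u)^{6L⁴−3}`;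
* `ballVol_le_four_mul_cube` — `ballVol r ≤ 4r³` (✓`SU2HaarSmallBallUpper`);
* ★★★ `log_volume_ceiling` — with the four-letter CEILING ✓`NearlyCommutingCeiling.haar_pi_nearlyCommuting_le` (`≤ C·s⁶·log s⁻¹`):
  `∀ L, ∃ C > 0, ∃ u₀ > 0, ∀ u ∈ (0,u₀], (ringMeasure L).real {F₀ ≤ u} ≤ C·u^{9L⁴−3/2}·log u⁻¹` — exponent `3 + (3/2)(6L⁴ − 3) = 9L⁴ − 3/2`
  and ONE logarithm, matching ✓`log_volume_floor` from above: at every fixed `L` the sublevel volumes of the periodic ring deficit are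
  `≍ u^{9L⁴−3/2}·log u⁻¹` (the SHAPE of `ToronTubeVolumeLaw` at fixed `L`; no statement about `poly(L)` constants or the `t^θ` remainder).
HONEST LABEL: the fixed-`L` rung of ⟨24497⟩ with constants of size `exp(O(L⁴ log L))`; ⟨24497⟩, ⟨24196⟩, ⟨24197⟩ stay OPEN; no crux, rung or summit is proved;
the Yang–Mills mass gap is NOT proved; no summit is proved by a line.  Seat ym-line-fcl-p3 g43 (cell ym-idea-1, free hands; `--supports stmt-QuantumFields-24497`).
THEOREMS ONLY (0 `def`, 0 `sorry`), standard axioms.  References: [cite: Luscher1983, §2]; [cite: Vanbaal2001]; [cite: Chatterjee2016, Lemma 9.3]; [folklore].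
-/

set_option autoImplicit false

noncomputable section

open MeasureTheory
open scoped BigOperators ENNReal Quaternion
open Literature.MathematicalPhysics.QuantumFieldTheory hiding SU2 su2Quat_mul
open Literature.MathematicalPhysics.QuantumLattice
open Summit.QuantumFields.YangMills.Theorems.FemtoTransferGap
open Summit.QuantumFields.YangMills.Theorems.FemtoTransferGap.TT
open Summit.QuantumFields.YangMills.Theorems.VirialFluxGap.RingDeficit
open Summit.QuantumFields.YangMills.Theorems.VirialFluxGap.TreeGaugeTransfer (measureReal_deficit_le_eq_fix)
open Summit.QuantumFields.YangMills.Theorems.VirialFluxGap.FixSplit (card_offIdx)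
open Summit.QuantumFields.YangMills.Theorems.SwapTwistDeficit.PeriodicRingFloor

namespace Summit.QuantumFields.YangMills.Theorems.ToronValleyVolume.PeriodicRingCeiling

variable {L : ℕ} [NeZero L]

/-! ## §1 The sublevel volume is at most the mass of the nearly-commuting box -/

/-- ★★ **`μ_L{F₀ ≤ u} ≤ Haar⁴(E_s) · ballVol(t₂)^{6L⁴−3}`** with `s = 20L²√u` (quaternion commutators) and `t₂ = 12L²√u`: tree gauge
✓`measureReal_deficit_le_eq_fix`, the box inclusion ✓`commBox_of_ringDeficit`, and w3 g61's Fubini bookkeeping (change of variables `Ψ` made of letter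
translations = skew products, leader identification `Θ`, ✓`measure_leaderSet_eq`) reproduced with the inclusion reversed. [cite: Chatterjee2016, Lemma 9.3]
[cite: Luscher1983, §2] -/
theorem ringMeasure_real_deficit_le_le_box (u : ℝ) :
    (ringMeasure L).real {P | ringDeficit L (fun _ => false) P ≤ u} ≤
      (Measure.pi fun _ : Fin 4 => haarProbability SU2).real
          {C : Fin 4 → SU2 | ∀ k l : Fin 4, ‖su2Quat (C k) * su2Quat (C l) - su2Quat (C l) * su2Quat (C k)‖ ≤ 20 * (L : ℝ) ^ 2 * Real.sqrt u} *
        ballVol (12 * (L : ℝ) ^ 2 * Real.sqrt u) ^ (6 * L ^ 4 - 3) := by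
  haveI : (haarProbability SU2).IsMulLeftInvariant := by unfold haarProbability; infer_instance
  haveI : IsProbabilityMeasure (gaugeMeasure L) := isProbabilityMeasure_gaugeMeasure (L := L)
  set s : ℝ := 20 * (L : ℝ) ^ 2 * Real.sqrt u with hs_def
  set t₂ : ℝ := 12 * (L : ℝ) ^ 2 * Real.sqrt u with ht₂_def
  have ht₂ : 0 ≤ t₂ := by positivity
  set E : Set (Fin 4 → SU2) := {C : Fin 4 → SU2 | ∀ k l : Fin 4, ‖su2Quat (C k) * su2Quat (C l) - su2Quat (C l) * su2Quat (C k)‖ ≤ s} with hE_def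
  have hEm : MeasurableSet E := measurableSet_nearlyCommuting s
  -- the three factors of `X_fix` and their measures (verbatim from ✓`pi_real_mul_ballVol_pow_le_ringMeasure_real_deficit_le`)
  set μA : Measure (OffIdx L → SU2) := Measure.pi fun _ : OffIdx L => haarProbability SU2 with hμA
  set μB : Measure (Fin (2 * L - 1) → GaugeConfig 3 L SU2) := Measure.pi fun _ : Fin (2 * L - 1) => configMeasure SU2 L with hμB
  set μC : Measure (Site 3 L → SU2) := gaugeMeasure L with hμC
  set π4 : Measure (Fin 4 → SU2) := Measure.pi fun _ : Fin 4 => haarProbability SU2 with hπ4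
  -- the fluctuation ball
  set B₂ : Set SU2 := {W : SU2 | frobNorm ((W : Matrix (Fin 2) (Fin 2) ℂ) - 1) ≤ t₂} with hB₂
  have hB₂m : MeasurableSet B₂ := measurableSet_frobBall_one t₂
  /- (A) slice 0: leaders and letters -/
  set Lead : Fin 3 → OffIdx L := fun μ => ⟨(Pi.single μ (-1 : ZMod L), μ), leader_not_treeEdge μ⟩ with hLead
  have hLead_inj : Function.Injective Lead := fun μ ν h => by
    have := congrArg (fun i : OffIdx L => i.1.2) h
    simpa [hLead] using this
  set pA : OffIdx L → Prop := fun i => ∃ μ, i = Lead μ with hpA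
  set πA₁ : Measure ({i // pA i} → SU2) := Measure.pi fun _ => haarProbability SU2 with hπA₁
  set πA₂ : Measure ({i // ¬pA i} → SU2) := Measure.pi fun _ => haarProbability SU2 with hπA₂
  set eA := MeasurableEquiv.piEquivPiSubtypeProd (fun _ : OffIdx L => SU2) pA with heA_def
  have heA : MeasurePreserving eA μA (πA₁.prod πA₂) := measurePreserving_piEquivPiSubtypeProd (fun _ : OffIdx L => haarProbability SU2) pA
  set cA : ({i // pA i} → SU2) → OffIdx L → SU2 := fun a i =>
    (if i.1.1 i.1.2 = -1 then a ⟨Lead i.1.2, ⟨i.1.2, rfl⟩⟩ else 1)⁻¹ with hcA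
  set ΦA : ({i // pA i} → SU2) → ({i // ¬pA i} → SU2) → ({i // ¬pA i} → SU2) := fun a b i => cA a i.1 * b i with hΦA
  have hΦAa : ∀ a, MeasurePreserving (ΦA a) πA₂ πA₂ := fun a =>
    measurePreserving_pi (fun _ : {i // ¬pA i} => haarProbability SU2) (fun _ : {i // ¬pA i} => haarProbability SU2)
      fun i => measurePreserving_mul_left (haarProbability SU2) (cA a i.1)
  have hcAm : ∀ i : OffIdx L, Measurable fun a : {i // pA i} → SU2 => cA a i := by
    intro i
    by_cases hsx : i.1.1 i.1.2 = -1
    · simp only [hcA, hsx, if_true]; exact (measurable_pi_apply _).inv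
    · simp only [hcA, hsx, if_false, inv_one]; exact measurable_const
  have hΦAm : Measurable (Function.uncurry ΦA) := by
    refine measurable_pi_lambda _ fun i => ?_
    exact ((hcAm i.1).comp measurable_fst).mul ((measurable_pi_apply i).comp measurable_snd)
  set skA : ({i // pA i} → SU2) × ({i // ¬pA i} → SU2) → ({i // pA i} → SU2) × ({i // ¬pA i} → SU2) :=
    fun z => (id z.1, ΦA z.1 z.2) with hskA
  have hskewA : MeasurePreserving skA (πA₁.prod πA₂) (πA₁.prod πA₂) :=
    (MeasurePreserving.id πA₁).skew_product hΦAm (ae_of_all _ fun a => (hΦAa a).map_eq)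
  have hψA : MeasurePreserving (fun w => skA (eA w)) μA (πA₁.prod πA₂) := hskewA.comp heA
  /- (C) the seam field: leader `g 0` (an opaque copy of the predicate `x = 0`, so that `{x // pC x}` carries the generic instances) -/
  obtain ⟨pC, hpC⟩ : ∃ p : Site 3 L → Prop, ∀ x, p x ↔ x = 0 := ⟨fun x => x = 0, fun _ => Iff.rfl⟩
  haveI hdecC : DecidablePred pC := fun x => decidable_of_iff _ (hpC x).symm
  have hp0 : pC 0 := (hpC 0).2 rfl
  set πC₁ : Measure ({x // pC x} → SU2) := Measure.pi fun _ => haarProbability SU2 with hπC₁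
  set πC₂ : Measure ({x // ¬pC x} → SU2) := Measure.pi fun _ => haarProbability SU2 with hπC₂
  set eC := MeasurableEquiv.piEquivPiSubtypeProd (fun _ : Site 3 L => SU2) pC with heC_def
  have heC : MeasurePreserving eC μC (πC₁.prod πC₂) := by
    have hμC' : μC = Measure.pi fun _ : Site 3 L => haarProbability SU2 := rfl
    rw [hμC']
    exact measurePreserving_piEquivPiSubtypeProd (fun _ : Site 3 L => haarProbability SU2) pC
  set ΦC : ({x // pC x} → SU2) → ({x // ¬pC x} → SU2) → ({x // ¬pC x} → SU2) := fun a b x => (a ⟨0, hp0⟩)⁻¹ * b x with hΦC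
  have hΦCa : ∀ a, MeasurePreserving (ΦC a) πC₂ πC₂ := fun a =>
    measurePreserving_pi (fun _ : {x // ¬pC x} => haarProbability SU2) (fun _ : {x // ¬pC x} => haarProbability SU2)
      fun _ => measurePreserving_mul_left (haarProbability SU2) _
  have hΦCm : Measurable (Function.uncurry ΦC) := by
    refine measurable_pi_lambda _ fun x => ?_
    exact ((measurable_pi_apply _).inv.comp measurable_fst).mul ((measurable_pi_apply x).comp measurable_snd)
  set skC : ({x // pC x} → SU2) × ({x // ¬pC x} → SU2) → ({x // pC x} → SU2) × ({x // ¬pC x} → SU2) :=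
    fun z => (id z.1, ΦC z.1 z.2) with hskC
  have hskewC : MeasurePreserving skC (πC₁.prod πC₂) (πC₁.prod πC₂) :=
    (MeasurePreserving.id πC₁).skew_product hΦCm (ae_of_all _ fun a => (hΦCa a).map_eq)
  have hψC : MeasurePreserving (fun g => skC (eC g)) μC (πC₁.prod πC₂) := hskewC.comp heC
  /- (B) the slices `1 … 2L−1`, translated by `glue w` -/
  set τ : (OffIdx L → SU2) → (Fin (2 * L - 1) → GaugeConfig 3 L SU2) → (Fin (2 * L - 1) → GaugeConfig 3 L SU2) :=
    fun w r j e => (glue w e)⁻¹ * r j e with hτ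
  have hτw : ∀ w, MeasurePreserving (τ w) μB μB := fun w => by
    have hin : MeasurePreserving (fun (U : GaugeConfig 3 L SU2) (e : Edge 3 L) => (glue w e)⁻¹ * U e)
        (configMeasure SU2 L) (configMeasure SU2 L) := by
      unfold configMeasure
      exact measurePreserving_pi (fun _ : Edge 3 L => haarProbability SU2) (fun _ : Edge 3 L => haarProbability SU2)
        fun e => measurePreserving_mul_left (haarProbability SU2) ((glue w e)⁻¹)
    exact measurePreserving_pi (fun _ : Fin (2 * L - 1) => configMeasure SU2 L) (fun _ : Fin (2 * L - 1) => configMeasure SU2 L)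
      fun _ => hin
  set Ψ₁ : (OffIdx L → SU2) × ((Fin (2 * L - 1) → GaugeConfig 3 L SU2) × (Site 3 L → SU2)) →
      (OffIdx L → SU2) × ((Fin (2 * L - 1) → GaugeConfig 3 L SU2) × (Site 3 L → SU2)) :=
    fun x => (id x.1, (τ x.1 x.2.1, x.2.2)) with hΨ₁
  have hfibm : Measurable (Function.uncurry fun (w : OffIdx L → SU2)
      (q : (Fin (2 * L - 1) → GaugeConfig 3 L SU2) × (Site 3 L → SU2)) => (τ w q.1, q.2)) := by
    refine Measurable.prodMk ?_ (measurable_snd.comp measurable_snd)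
    refine measurable_pi_lambda _ fun j => measurable_pi_lambda _ fun e => ?_
    exact (((measurable_pi_apply e).comp (measurable_glue.comp measurable_fst)).inv).mul
      ((measurable_pi_apply e).comp ((measurable_pi_apply j).comp (measurable_fst.comp measurable_snd)))
  have hfib : ∀ w, MeasurePreserving (fun q : (Fin (2 * L - 1) → GaugeConfig 3 L SU2) × (Site 3 L → SU2) => (τ w q.1, q.2))
      (μB.prod μC) (μB.prod μC) := fun w => (hτw w).prod (MeasurePreserving.id μC)
  have hΨ₁m : MeasurePreserving Ψ₁ (μA.prod (μB.prod μC)) (μA.prod (μB.prod μC)) :=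
    (MeasurePreserving.id μA).skew_product hfibm (ae_of_all _ fun w => (hfib w).map_eq)
  set Ψ₂ : (OffIdx L → SU2) × ((Fin (2 * L - 1) → GaugeConfig 3 L SU2) × (Site 3 L → SU2)) →
      (({i // pA i} → SU2) × ({i // ¬pA i} → SU2)) ×
        ((Fin (2 * L - 1) → GaugeConfig 3 L SU2) × (({x // pC x} → SU2) × ({x // ¬pC x} → SU2))) :=
    Prod.map (fun w => skA (eA w)) (Prod.map id fun g => skC (eC g)) with hΨ₂
  have hΨ₂m : MeasurePreserving Ψ₂ (μA.prod (μB.prod μC)) ((πA₁.prod πA₂).prod (μB.prod (πC₁.prod πC₂))) :=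
    hψA.prod ((MeasurePreserving.id μB).prod hψC)
  have hΨ : MeasurePreserving (fun x => Ψ₂ (Ψ₁ x)) (μA.prod (μB.prod μC)) ((πA₁.prod πA₂).prod (μB.prod (πC₁.prod πC₂))) :=
    hΨ₂m.comp hΨ₁m
  /- (Θ) the two leader factors as one point of `Fin 4 → SU(2)` -/
  set e3 : Fin 3 ≃ {i // pA i} := Equiv.ofBijective (fun μ => ⟨Lead μ, ⟨μ, rfl⟩⟩)
    ⟨fun μ ν h => hLead_inj (congrArg Subtype.val h), fun i => by
      obtain ⟨μ, hμ⟩ := i.2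
      exact ⟨μ, Subtype.ext hμ.symm⟩⟩ with he3
  set eA1 : ({i // pA i} → SU2) ≃ᵐ (Fin 3 → SU2) := (MeasurableEquiv.piCongrLeft (fun _ : {i // pA i} => SU2) e3).symm with heA1
  have hA1 : MeasurePreserving eA1 πA₁ (Measure.pi fun _ : Fin 3 => haarProbability SU2) :=
    MeasurePreserving.symm _ (measurePreserving_piCongrLeft (fun _ : {i // pA i} => haarProbability SU2) e3)
  set eC1 : ({x // pC x} → SU2) → SU2 := fun a => a ⟨0, hp0⟩ with heC1
  have hC1 : MeasurePreserving eC1 πC₁ (haarProbability SU2) :=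
    measurePreserving_eval (fun _ : {x // pC x} => haarProbability SU2) ⟨0, hp0⟩
  set e4 := MeasurableEquiv.piFinSuccAbove (fun _ : Fin 4 => SU2) (Fin.last 3) with he4
  have h4 : MeasurePreserving e4 π4 ((haarProbability SU2).prod (Measure.pi fun _ : Fin 3 => haarProbability SU2)) :=
    measurePreserving_piFinSuccAbove (fun _ : Fin 4 => haarProbability SU2) (Fin.last 3)
  set Θ : ({i // pA i} → SU2) × ({x // pC x} → SU2) → (Fin 4 → SU2) :=
    fun z => e4.symm (Prod.map eC1 eA1 (Prod.swap z)) with hΘ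
  have hΘm : MeasurePreserving Θ (πA₁.prod πC₁) π4 :=
    ((MeasurePreserving.symm e4 h4).comp (hC1.prod hA1)).comp Measure.measurePreserving_swap
  have hΘ_cast : ∀ (z : ({i // pA i} → SU2) × ({x // pC x} → SU2)) (μ : Fin 3),
      Θ z (Fin.castSucc μ) = z.1 ⟨Lead μ, ⟨μ, rfl⟩⟩ := by
    intro z μ
    simp only [hΘ, he4, heC1, heA1, Prod.map, Prod.swap, MeasurableEquiv.piFinSuccAbove_symm_apply, Fin.insertNthEquiv_apply,
      Fin.insertNth_last', Fin.snoc_castSucc]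
    rfl
  have hΘ_last : ∀ (z : ({i // pA i} → SU2) × ({x // pC x} → SU2)), Θ z (Fin.last 3) = z.2 ⟨0, hp0⟩ := by
    intro z
    simp only [hΘ, he4, heC1, Prod.map, Prod.swap, MeasurableEquiv.piFinSuccAbove_symm_apply, Fin.insertNthEquiv_apply,
      Fin.insertNth_last', Fin.snoc_last]
  /- the target set and the toron event -/
  set F : Set (({i // pA i} → SU2) × ({x // pC x} → SU2)) := Θ ⁻¹' E with hF
  have hFm : MeasurableSet F := hEm.preimage hΘm.measurable
  set SA : Set ({i // ¬pA i} → SU2) := Set.pi Set.univ fun _ => B₂ with hSA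
  set SB : Set (Fin (2 * L - 1) → GaugeConfig 3 L SU2) := Set.pi Set.univ fun _ => Set.pi Set.univ fun _ => B₂ with hSB
  set SC : Set ({x // ¬pC x} → SU2) := Set.pi Set.univ fun _ => B₂ with hSC
  have hSAm : MeasurableSet SA := MeasurableSet.univ_pi fun _ => hB₂m
  have hSBm : MeasurableSet SB := MeasurableSet.univ_pi fun _ => MeasurableSet.univ_pi fun _ => hB₂m
  have hSCm : MeasurableSet SC := MeasurableSet.univ_pi fun _ => hB₂m
  set T : Set ((({i // pA i} → SU2) × ({i // ¬pA i} → SU2)) ×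
      ((Fin (2 * L - 1) → GaugeConfig 3 L SU2) × (({x // pC x} → SU2) × ({x // ¬pC x} → SU2)))) :=
    {z | (z.1.1, z.2.2.1) ∈ F ∧ z.1.2 ∈ SA ∧ z.2.1 ∈ SB ∧ z.2.2.2 ∈ SC} with hT
  have hTm : MeasurableSet T := by
    have h1 : Measurable fun z : (({i // pA i} → SU2) × ({i // ¬pA i} → SU2)) ×
        ((Fin (2 * L - 1) → GaugeConfig 3 L SU2) × (({x // pC x} → SU2) × ({x // ¬pC x} → SU2))) => (z.1.1, z.2.2.1) :=
      measurable_fst.fst.prodMk measurable_snd.snd.fst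
    exact ((hFm.preimage h1).inter (hSAm.preimage measurable_fst.snd)).inter
      ((hSBm.preimage measurable_snd.fst).inter (hSCm.preimage measurable_snd.snd.snd)) |>.congr
      (by ext z; simp only [hT, Set.mem_inter_iff, Set.mem_preimage, Set.mem_setOf_eq, and_assoc])
  set P : Set ((OffIdx L → SU2) × ((Fin (2 * L - 1) → GaugeConfig 3 L SU2) × (Site 3 L → SU2))) :=
    (fun x => Ψ₂ (Ψ₁ x)) ⁻¹' T with hP
  /- (1) the mass of the toron event -/
  have hcardA₁ : Fintype.card {i // pA i} = 3 := by
    have hmem : ∀ i : OffIdx L, i ∈ Finset.univ.image Lead ↔ pA i := fun i => by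
      simp only [Finset.mem_image, Finset.mem_univ, true_and]
      constructor
      · rintro ⟨μ, h⟩; exact ⟨μ, h.symm⟩
      · rintro ⟨μ, h⟩; exact ⟨μ, h.symm⟩
    rw [Fintype.card_of_subtype (Finset.univ.image Lead) hmem, Finset.card_image_of_injective _ hLead_inj, Finset.card_univ,
      Fintype.card_fin]
  have hcardA₂ : Fintype.card {i // ¬pA i} = 2 * L ^ 3 + 1 - 3 := by
    rw [Fintype.card_subtype_compl, hcardA₁, card_offIdx]
  have hcardC₁ : Fintype.card {x // pC x} = 1 := by
    rw [Fintype.card_of_subtype ({0} : Finset (Site 3 L)) (fun x => by rw [Finset.mem_singleton]; exact (hpC x).symm),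
      Finset.card_singleton]
  have hcardC₂ : Fintype.card {x // ¬pC x} = L ^ 3 - 1 := by
    rw [Fintype.card_subtype_compl, hcardC₁, TwoLattice.Electric.card_site]
  have hSBmass : μB SB = (haarProbability SU2 B₂ ^ Fintype.card (Edge 3 L)) ^ (2 * L - 1) := by
    rw [hμB, hSB, Measure.pi_pi]
    simp only [configMeasure, Measure.pi_pi, Finset.prod_const, Finset.card_univ, Fintype.card_fin]
  have hPmass : (μA.prod (μB.prod μC)) P = π4 E * haarProbability SU2 B₂ ^ (6 * L ^ 4 - 3) := by
    have h1 : (μA.prod (μB.prod μC)) P = ((πA₁.prod πA₂).prod (μB.prod (πC₁.prod πC₂))) T :=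
      hΨ.measure_preimage hTm.nullMeasurableSet
    have h2 : (πA₁.prod πC₁) F = π4 E := hΘm.measure_preimage hEm.nullMeasurableSet
    rw [h1, hT, measure_leaderSet_eq πA₁ πA₂ μB πC₁ πC₂ hFm hSAm hSBm hSCm, h2, hSBmass, hSA, hSC, hπA₂, hπC₂, Measure.pi_pi,
      Measure.pi_pi]
    simp only [Finset.prod_const, Finset.card_univ, hcardA₂, hcardC₂, FemtoTransferGap.card_edge_three]
    rw [← card_nonleaders (L := L) NeZero.one_le]
    ring
  /- (2) a small deficit puts the history INTO the event (✓`commBox_of_ringDeficit`) -/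
  have hPsup : {x : (OffIdx L → SU2) × ((Fin (2 * L - 1) → GaugeConfig 3 L SU2) × (Site 3 L → SU2)) |
      ringDeficit L (fun _ => false) ((Fin.cons (glue x.1) x.2.1 : Fin (2 * L - 1 + 1) → GaugeConfig 3 L SU2), x.2.2) ≤ u} ⊆ P := by
    rintro ⟨w, r, g⟩ hx
    simp only [Set.mem_setOf_eq] at hx
    obtain ⟨hCC, hcC, hw, hr, hg⟩ := commBox_of_ringDeficit w r g
    -- `√F₀ ≤ √u`
    have hδ : Real.sqrt (ringDeficit L (fun _ => false) ((Fin.cons (glue w) r : Fin (2 * L - 1 + 1) → GaugeConfig 3 L SU2), g)) ≤ Real.sqrt u :=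
      Real.sqrt_le_sqrt hx
    have hL0 : (0 : ℝ) ≤ 12 * (L : ℝ) ^ 2 := by positivity
    have hL0' : (0 : ℝ) ≤ 20 * (L : ℝ) ^ 2 := by positivity
    have ht₂' : 12 * (L : ℝ) ^ 2 * Real.sqrt (ringDeficit L (fun _ => false)
        ((Fin.cons (glue w) r : Fin (2 * L - 1 + 1) → GaugeConfig 3 L SU2), g)) ≤ t₂ := mul_le_mul_of_nonneg_left hδ hL0
    have hs' : 20 * (L : ℝ) ^ 2 * Real.sqrt (ringDeficit L (fun _ => false)
        ((Fin.cons (glue w) r : Fin (2 * L - 1 + 1) → GaugeConfig 3 L SU2), g)) ≤ s := mul_le_mul_of_nonneg_left hδ hL0'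
    -- quaternion commutators from Frobenius commutators (`‖[q,q]‖ = ‖·‖_F/√2 ≤ ‖·‖_F`)
    have hq_of_frob : ∀ x y : SU2, ∀ b : ℝ,
        frobNorm (((x * y : SU2) : Matrix (Fin 2) (Fin 2) ℂ) - ((y * x : SU2) : Matrix (Fin 2) (Fin 2) ℂ)) ≤ b →
          ‖su2Quat x * su2Quat y - su2Quat y * su2Quat x‖ ≤ b := by
      intro x y b h
      rw [frobNorm_comm_eq_sqrt_two_mul] at h
      have h2 : 1 ≤ Real.sqrt 2 := by rw [Real.le_sqrt' one_pos]; norm_num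
      have hn := norm_nonneg (su2Quat x * su2Quat y - su2Quat y * su2Quat x)
      nlinarith
    have hleadA : ∀ μ : Fin 3, Θ ((skA (eA w)).1, (skC (eC g)).1) (Fin.castSucc μ) = w (Lead μ) := fun μ => by
      rw [hΘ_cast]; rfl
    have hleadC : Θ ((skA (eA w)).1, (skC (eC g)).1) (Fin.last 3) = g 0 := by
      rw [hΘ_last]; rfl
    show Ψ₂ (Ψ₁ (w, r, g)) ∈ T
    simp only [hT, hΨ₂, hΨ₁, Prod.map_apply, id, Set.mem_setOf_eq]
    refine ⟨?_, ?_, ?_, ?_⟩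
    · -- leaders in `E`
      show Θ ((skA (eA w)).1, (skC (eC g)).1) ∈ E
      simp only [hE_def, Set.mem_setOf_eq]
      intro k l
      cases k using Fin.lastCases with
      | last =>
        cases l using Fin.lastCases with
        | last => rw [sub_self, norm_zero]; positivity
        | cast ν =>
          rw [hleadC, hleadA]
          exact hq_of_frob _ _ _ ((hcC ν).trans hs')
      | cast μ =>
        cases l using Fin.lastCases with
        | last =>
          rw [hleadC, hleadA, ← norm_neg, neg_sub]
          exact hq_of_frob _ _ _ ((hcC μ).trans hs')
        | cast ν =>
          rw [hleadA, hleadA]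
          exact hq_of_frob _ _ _ ((hCC μ ν).trans hs')
    · -- the other off-tree links of slice 0
      refine Set.mem_univ_pi.2 fun i => ?_
      simp only [hskA, hΦA, hcA, heA_def, MeasurableEquiv.piEquivPiSubtypeProd_apply, hB₂, Set.mem_setOf_eq]
      exact (hw i.1).trans ht₂'
    · -- the slices
      refine Set.mem_univ_pi.2 fun j => Set.mem_univ_pi.2 fun e => ?_
      simp only [hτ, hB₂, Set.mem_setOf_eq]
      exact (hr j e).trans ht₂'
    · -- the seam
      refine Set.mem_univ_pi.2 fun x => ?_
      simp only [hskC, hΦC, heC_def, MeasurableEquiv.piEquivPiSubtypeProd_apply, hB₂, Set.mem_setOf_eq]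
      exact (hg x.1).trans ht₂'
  /- (3) assemble in real numbers -/
  haveI : IsProbabilityMeasure (μA.prod (μB.prod μC)) := by
    rw [hμA, hμB, hμC]; infer_instance
  rw [measureReal_deficit_le_eq_fix]
  calc ((μA.prod (μB.prod μC))).real {x | ringDeficit L (fun _ => false)
          ((Fin.cons (glue x.1) x.2.1 : Fin (2 * L - 1 + 1) → GaugeConfig 3 L SU2), x.2.2) ≤ u}
      ≤ ((μA.prod (μB.prod μC)) P).toReal := by
        rw [← measureReal_def]
        exact measureReal_mono hPsup (measure_ne_top _ _)
    _ = π4.real E * ballVol t₂ ^ (6 * L ^ 4 - 3) := by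
        rw [hPmass, ENNReal.toReal_mul, ENNReal.toReal_pow]; rfl

/-! ## §2 The one-letter small ball and the final ceiling -/

/-- `ballVol r ≤ 4r³` for `r > 0` (✓`haarProbability_su2_two_sub_trace_lt_le`, `‖W − 1‖_F² = 2(2 − Re tr W)`). [folklore] -/
theorem ballVol_le_four_mul_cube {r : ℝ} (hr : 0 < r) : ballVol r ≤ 4 * r ^ 3 := by
  have hsub : {W : SU2 | frobNorm ((W : Matrix (Fin 2) (Fin 2) ℂ) - 1) ≤ r} ⊆
      {U : SU2 | 2 - ((U : Matrix (Fin 2) (Fin 2) ℂ).trace).re < r ^ 2} := by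
    intro W hW
    simp only [Set.mem_setOf_eq] at hW ⊢
    have h := frobNorm_sub_one_sq W
    have h0 : 0 ≤ frobNorm ((W : Matrix (Fin 2) (Fin 2) ℂ) - 1) := frobNorm_nonneg _
    have h2 : frobNorm ((W : Matrix (Fin 2) (Fin 2) ℂ) - 1) ^ 2 ≤ r ^ 2 := pow_le_pow_left₀ h0 hW 2
    nlinarith
  have h := haarProbability_su2_two_sub_trace_lt_le hr
  unfold ballVol
  rw [measureReal_def]
  calc ((haarProbability SU2) {W : SU2 | frobNorm ((W : Matrix (Fin 2) (Fin 2) ℂ) - 1) ≤ r}).toReal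
      ≤ ((haarProbability SU2) {U : SU2 | 2 - ((U : Matrix (Fin 2) (Fin 2) ℂ).trace).re < r ^ 2}).toReal :=
        ENNReal.toReal_mono (measure_ne_top _ _) (measure_mono hsub)
    _ ≤ 4 * r ^ 3 := ENNReal.toReal_le_of_le_ofReal (by positivity) h

/-- ★★★ **THE FIXED-`L` PERIODIC CEILING WITH ITS LOGARITHM.**  For every `L` there are `C > 0` and `u₀ > 0` with
`(ringMeasure L).real {F₀ ≤ u} ≤ C · u^{9L⁴−3/2} · log u⁻¹` for all `0 < u ≤ u₀`: leaders in the four-letter event of radius `s = 20L²√u`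
(Haar⁴-mass `≤ C₄ s⁶ log s⁻¹`, ✓`NearlyCommutingCeiling.haar_pi_nearlyCommuting_le`), fluctuations in balls of radius `t₂ = 12L²√u` (`ballVol ≤ 4t₂³` each,
`6L⁴ − 3` of them), `3 + (3/2)(6L⁴−3) = 9L⁴ − 3/2`, and `log s⁻¹ ≤ ½·log u⁻¹`.  Together with ✓`PeriodicRingFloor.log_volume_floor`:
`μ_L{F₀ ≤ u} ≍ u^{9L⁴−3/2}·log u⁻¹` at every fixed `L`. [cite: Luscher1983, §2] [cite: Vanbaal2001] -/
theorem log_volume_ceiling (L : ℕ) [NeZero L] :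
    ∃ C : ℝ, 0 < C ∧ ∃ u₀ : ℝ, 0 < u₀ ∧ ∀ u : ℝ, 0 < u → u ≤ u₀ →
      (ringMeasure L).real {P | ringDeficit L (fun _ => false) P ≤ u} ≤ C * u ^ (9 * (L : ℝ) ^ 4 - 3 / 2) * Real.log u⁻¹ := by
  obtain ⟨C₄, hC₄, t₀, ht₀, hceil⟩ := NearlyCommutingCeiling.haar_pi_nearlyCommuting_le
  have hL1 : (1 : ℝ) ≤ L := by exact_mod_cast NeZero.one_le
  have hL4 : 1 ≤ L ^ 4 := Nat.one_le_pow _ _ NeZero.one_le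
  set A : ℝ := 20 * (L : ℝ) ^ 2 with hA
  set B : ℝ := 12 * (L : ℝ) ^ 2 with hB
  have hA1 : 1 ≤ A := by rw [hA]; nlinarith
  have hA0 : 0 < A := by linarith
  have hB0 : 0 < B := by rw [hB]; positivity
  set N : ℕ := 6 * L ^ 4 - 3 with hN
  have hNreal : (N : ℝ) = 6 * (L : ℝ) ^ 4 - 3 := by
    rw [hN, Nat.cast_sub (by omega), Nat.cast_mul, Nat.cast_pow]; norm_num
  -- threshold: `A√u ≤ min t₀ 1` and `u ≤ 1/4`
  have hm0 : 0 < min t₀ 1 := lt_min ht₀ one_pos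
  set u₀ : ℝ := min (1 / 4) ((min t₀ 1 / A) ^ 2) with hu₀
  have hu₀pos : 0 < u₀ := lt_min (by norm_num) (by positivity)
  refine ⟨C₄ * A ^ 6 * (4 * B ^ 3) ^ N, by positivity, u₀, hu₀pos, fun u hu huu₀ => ?_⟩
  have hu14 : u ≤ 1 / 4 := huu₀.trans (min_le_left _ _)
  have hu1 : u < 1 := by linarith
  have hsu : 0 < Real.sqrt u := Real.sqrt_pos.2 hu
  have hs0 : 0 < A * Real.sqrt u := by positivity
  have hsm : A * Real.sqrt u ≤ min t₀ 1 := by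
    have h1 : u ≤ (min t₀ 1 / A) ^ 2 := huu₀.trans (min_le_right _ _)
    have h2 : Real.sqrt u ≤ min t₀ 1 / A := by
      rw [← Real.sqrt_sq (by positivity : (0 : ℝ) ≤ min t₀ 1 / A)]; exact Real.sqrt_le_sqrt h1
    calc A * Real.sqrt u ≤ A * (min t₀ 1 / A) := mul_le_mul_of_nonneg_left h2 hA0.le
      _ = min t₀ 1 := by field_simp
  have hst₀ : A * Real.sqrt u ≤ t₀ := hsm.trans (min_le_left _ _)
  have hs1 : A * Real.sqrt u ≤ 1 := hsm.trans (min_le_right _ _)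
  have hbox := ringMeasure_real_deficit_le_le_box (L := L) u
  have hE : (Measure.pi fun _ : Fin 4 => haarProbability SU2).real
      {C : Fin 4 → SU2 | ∀ k l : Fin 4, ‖su2Quat (C k) * su2Quat (C l) - su2Quat (C l) * su2Quat (C k)‖ ≤ 20 * (L : ℝ) ^ 2 * Real.sqrt u} ≤
        C₄ * (A * Real.sqrt u) ^ 6 * Real.log (A * Real.sqrt u)⁻¹ := by
    have h := hceil (A * Real.sqrt u) hs0 hst₀
    rwa [hA] at h ⊢
  have hball : ballVol (12 * (L : ℝ) ^ 2 * Real.sqrt u) ≤ 4 * (B * Real.sqrt u) ^ 3 := by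
    rw [← hB]; exact ballVol_le_four_mul_cube (by positivity)
  have hballN : ballVol (12 * (L : ℝ) ^ 2 * Real.sqrt u) ^ N ≤ (4 * (B * Real.sqrt u) ^ 3) ^ N :=
    pow_le_pow_left₀ (ballVol_nonneg _) hball N
  have hlog : Real.log (A * Real.sqrt u)⁻¹ ≤ Real.log u⁻¹ := by
    rw [Real.log_inv, Real.log_inv, Real.log_mul hA0.ne' hsu.ne', Real.log_sqrt hu.le]
    have hlA : 0 ≤ Real.log A := Real.log_nonneg hA1
    have hlu : Real.log u ≤ 0 := Real.log_nonpos hu.le hu1.le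
    linarith
  have hlog0 : 0 ≤ Real.log (A * Real.sqrt u)⁻¹ := Real.log_nonneg ((one_le_inv₀ hs0).2 hs1)
  have hE0 : 0 ≤ C₄ * (A * Real.sqrt u) ^ 6 * Real.log (A * Real.sqrt u)⁻¹ := by positivity
  -- the exponent: `(√u)^6 · ((√u)^3)^N = u^{9L⁴ − 3/2}`
  have hkey : Real.sqrt u ^ 6 * (Real.sqrt u ^ 3) ^ N = u ^ (9 * (L : ℝ) ^ 4 - 3 / 2) := by
    rw [← pow_mul, ← pow_add, Real.sqrt_eq_rpow, ← Real.rpow_natCast, ← Real.rpow_mul hu.le]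
    congr 1
    push_cast
    rw [hNreal]; ring
  calc (ringMeasure L).real {P | ringDeficit L (fun _ => false) P ≤ u}
      ≤ (Measure.pi fun _ : Fin 4 => haarProbability SU2).real
          {C : Fin 4 → SU2 | ∀ k l : Fin 4, ‖su2Quat (C k) * su2Quat (C l) - su2Quat (C l) * su2Quat (C k)‖ ≤ 20 * (L : ℝ) ^ 2 * Real.sqrt u} *
        ballVol (12 * (L : ℝ) ^ 2 * Real.sqrt u) ^ N := hbox
    _ ≤ (C₄ * (A * Real.sqrt u) ^ 6 * Real.log (A * Real.sqrt u)⁻¹) * (4 * (B * Real.sqrt u) ^ 3) ^ N :=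
        mul_le_mul hE hballN (pow_nonneg (ballVol_nonneg _) _) hE0
    _ ≤ (C₄ * (A * Real.sqrt u) ^ 6 * Real.log u⁻¹) * (4 * (B * Real.sqrt u) ^ 3) ^ N :=
        mul_le_mul_of_nonneg_right (mul_le_mul_of_nonneg_left hlog (by positivity)) (by positivity)
    _ = C₄ * A ^ 6 * (4 * B ^ 3) ^ N * (Real.sqrt u ^ 6 * (Real.sqrt u ^ 3) ^ N) * Real.log u⁻¹ := by
        rw [mul_pow, mul_pow, mul_pow]; ring_nf
    _ = C₄ * A ^ 6 * (4 * B ^ 3) ^ N * u ^ (9 * (L : ℝ) ^ 4 - 3 / 2) * Real.log u⁻¹ := by rw [hkey]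

end Summit.QuantumFields.YangMills.Theorems.ToronValleyVolume.PeriodicRingCeiling

end
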